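import Summits.CriticalPhenomena.PercolationContinuityZ3.Theorems.PercNearOneGluingNoHeavyLowerTailSahiTwoChainFKG
import HarnessLib

/-!
# Sahi's conjecture for FKG posets of dimension two: sublattices of a product of two chains

Support file of the one-cut programme (crux `NoHeavyLowerTail`, stmt-CriticalPhenomena-4575; cell `prim-masterthm`, seat P3, gen 16;
`run/shared/lean/prim/prim-masterthm/prim-masterthm-p3/HIERARCHY.md` §24(g); memo
`run/shared/lean/prim/prim-masterthm/FROM-prim-masterthm-p3-g16-TWO-CHAIN-COEFFICIENTS.md` §6).

**`sahiPositive_of_latticeEmbedding`**: let `(L, μ)` be a finite FKG poset — a lattice with a probability weight satisfying the FKG lattice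
condition — that admits an injective map `e : L → α × β` into a product of two finite chains preserving `⊓` and `⊔` (a sublattice of a product of two
chains; by Dilworth/Birkhoff these are exactly the finite distributive lattices whose poset of join-irreducibles has width `≤ 2`).  Then
`SahiPositive μ n` for every `n` — Sahi's Conjecture 5 [Sahi2008, Conj. 5; LiebSahi2021, Conj. 1.1] for all FKG posets of dimension two.
PROOF: push `μ` forward along `e` (zero outside the image; the lattice condition survives because `e` is a lattice embedding), extend each monotone
`f_i ≥ 0` to the product by `F_i(z) = max {f_i(a) : e(a) ≤ z}` (monotone, `≥ 0`, `F_i ∘ e = f_i`), and apply `sahiPositive_of_isFKGMeasure_prod`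
(`…SahiTwoChainFKG`) with `sahiE_pushWeight`.  HONEST FRAMING: dimension `≥ 3` (e.g. `{0,1}^k`, `k ≥ 3` = Kahn's form of `C_3`) remains OPEN.
Everything PROVED, standard axioms; no new definitions. [this work]
-/

noncomputable section

open scoped Classical

namespace Summit.CriticalPhenomena.PercolationContinuityZ3.Theorems

open Finset Function
open Literature.Combinatorics.Sahi2008

namespace SahiTwoChain

variable {L α β : Type*} [Lattice L] [Fintype L] [LinearOrder α] [Fintype α] [LinearOrder β] [Fintype β]

/-- The push-forward along an injective map, evaluated on the image. [this work] -/
theorem pushWeight_apply_of_injective {X Y : Type*} [Fintype X] (w : X → ℝ) {e : X → Y} (he : Injective e) (a : X) :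
    pushWeight w e (e a) = w a := by
  rw [pushWeight_apply, Finset.sum_eq_single a]
  · rw [if_pos rfl]
  · intro b _ hba
    rw [if_neg fun h => hba (he h)]
  · intro h
    exact absurd (mem_univ a) h

/-- The push-forward along a map vanishes off the image. [this work] -/
theorem pushWeight_apply_of_not_mem_range {X Y : Type*} [Fintype X] (w : X → ℝ) (e : X → Y) {y : Y} (hy : ∀ a, e a ≠ y) :
    pushWeight w e y = 0 := by
  rw [pushWeight_apply]
  exact Finset.sum_eq_zero fun b _ => by rw [if_neg (hy b)]

/-- **A lattice embedding pushes an FKG weight forward to an FKG weight.** [this work] -/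
theorem isFKGMeasure_pushWeight_of_latticeEmbedding (e : L → α × β) (he : Injective e) (hinf : ∀ a b, e (a ⊓ b) = e a ⊓ e b)
    (hsup : ∀ a b, e (a ⊔ b) = e a ⊔ e b) {μ : L → ℝ} (hμ : IsFKGMeasure μ) : IsFKGMeasure (pushWeight μ e) := by
  refine ⟨fun p => pushWeight_nonneg hμ.nonneg e p, by rw [sum_pushWeight, hμ.sum_eq_one], fun p q => ?_⟩
  by_cases hp : ∃ a, e a = p
  · by_cases hq : ∃ b, e b = q
    · obtain ⟨a, rfl⟩ := hp
      obtain ⟨b, rfl⟩ := hq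
      rw [pushWeight_apply_of_injective μ he, pushWeight_apply_of_injective μ he, ← hinf, ← hsup,
        pushWeight_apply_of_injective μ he, pushWeight_apply_of_injective μ he]
      exact hμ.mul_le_mul a b
    · push Not at hq
      rw [pushWeight_apply_of_not_mem_range μ e hq, mul_zero]
      exact mul_nonneg (pushWeight_nonneg hμ.nonneg e _) (pushWeight_nonneg hμ.nonneg e _)
  · push Not at hp
    rw [pushWeight_apply_of_not_mem_range μ e hp, zero_mul]
    exact mul_nonneg (pushWeight_nonneg hμ.nonneg e _) (pushWeight_nonneg hμ.nonneg e _)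

/-- **Sahi's Conjecture 5 for every FKG poset that is a sublattice of a product of two finite chains, at every order.** [this work] -/
theorem sahiPositive_of_latticeEmbedding [Nonempty β] (e : L → α × β) (he : Injective e) (hinf : ∀ a b, e (a ⊓ b) = e a ⊓ e b)
    (hsup : ∀ a b, e (a ⊔ b) = e a ⊔ e b) {μ : L → ℝ} (hμ : IsFKGMeasure μ) (n : ℕ) : SahiPositive μ n := by
  intro f hf hmono
  -- `e` is an order embedding
  have hemono : ∀ a b, a ≤ b ↔ e a ≤ e b := by
    intro a b
    constructor
    · intro hab
      have h := hinf a b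
      rw [inf_eq_left.2 hab] at h
      rw [h]
      exact inf_le_right
    · intro hab
      have h := hinf a b
      rw [inf_eq_left.2 hab] at h
      exact inf_eq_left.1 (he h)
  -- the monotone extensions `F_i(z) = max {f_i(a) : e a ≤ z}`
  let S : α × β → Finset L := fun z => univ.filter fun a => e a ≤ z
  let F : Fin n → α × β → ℝ := fun i z => if h : (S z).Nonempty then (S z).sup' h (f i) else 0
  have hF0 : ∀ i z, 0 ≤ F i z := by
    intro i z
    simp only [F]
    split_ifs with h
    · obtain ⟨a, ha⟩ := h
      exact (hf i a).trans (Finset.le_sup' (f i) ha)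
    · exact le_rfl
  have hFmono : ∀ i, Monotone (F i) := by
    intro i z z' hzz'
    have hSS : S z ⊆ S z' := by
      intro a ha
      simp only [S, Finset.mem_filter, Finset.mem_univ, true_and] at ha ⊢
      exact ha.trans hzz'
    simp only [F]
    by_cases h : (S z).Nonempty
    · have h' : (S z').Nonempty := h.mono hSS
      rw [dif_pos h, dif_pos h']
      exact Finset.sup'_le h _ fun a ha => Finset.le_sup' (f i) (hSS ha)
    · rw [dif_neg h]
      split_ifs with h'
      · obtain ⟨a, ha⟩ := h'
        exact (hf i a).trans (Finset.le_sup' (f i) ha)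
      · exact le_rfl
  have hFe : ∀ i, F i ∘ e = f i := by
    intro i
    funext a
    have ha : a ∈ S (e a) := by simp [S]
    have h : (S (e a)).Nonempty := ⟨a, ha⟩
    simp only [Function.comp_apply, F, dif_pos h]
    refine le_antisymm (Finset.sup'_le h _ fun b hb => hmono i ((hemono b a).2 ?_)) (Finset.le_sup' (f i) ha)
    simpa [S] using hb
  -- transport
  have key : sahiE μ n f = sahiE (pushWeight μ e) n F := by
    rw [sahiE_pushWeight]
    congr 1
    funext i
    exact (hFe i).symm
  rw [key]
  exact sahiPositive_of_isFKGMeasure_prod (isFKGMeasure_pushWeight_of_latticeEmbedding e he hinf hsup hμ) n F hF0 hFmono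

end SahiTwoChain

end Summit.CriticalPhenomena.PercolationContinuityZ3.Theorems
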